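import Summits.BirchSwinnertonDyer.BirchSwinnertonDyer.Theorems.AdditiveBranchIMCGordTwoRankZeroOffCaseOneFieldSupplyTwoR0Class
import HarnessLib

/-!
# Route `AdditiveBranchIMC`, crux `GordTwoRankZeroOffCaseOne` (stmt-BirchSwinnertonDyer-19357): (F2₂) the genus-class FIELD TWO over a road field in
# which `2` RAMIFIES — part 3/3: §5 FIELD 2 assembled at the Wan prime `2` and the typed supply `fieldTwoTwo_supply`

Theorems-side landing (prover bsd-addord-stub-2 g0, `--supports stmt-BirchSwinnertonDyer-19357`, helper only) of the pen's checked crux workfile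
`Cruxes/GordTwoRankZeroOffCaseOne/WanAnyFieldTwoR0Landing.lean` (bsd-addord-plan gen 44, commit 7fa9383eae77; = `WanAnyFieldTwoR0.lean` v2 b8469de9518d),
declarations and proofs VERBATIM, split MECHANICALLY along its sections (part 1 = `…FieldSupplyTwoR0Aux` §1–§3; part 2 = `…FieldSupplyTwoR0Class` §4).
This part: §5 `exists_fieldTwo_gordTwo_two` (verbatim port of `exists_fieldTwo_gordTwo` with `q := 2`) and `fieldTwoTwo_supply`, whose statement is
literally the body of `WanAnyRoad.FieldTwoTwo` (`AdditiveBranchIMCGordTwoRankZeroOffCaseOneWanAnyRoadR0`) — so the v36 candidate's `stub_fieldTwoDyadicWan :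
FieldTwoTwo` closes by this name. 0 sorries. BSD is proved for no curve by any of this.
[cite: FriedbergHoffstein1995, Theorem B] [cite: HoffsteinLuo1997, Theorem] [cite: SilvermanAEC2009, X.5 Cor. 5.4, VII.5.1 and Thm VII.6.1]
-/

set_option linter.dupNamespace false

noncomputable section

open scoped Classical

open WeierstrassCurve NumberField IsDedekindDomain Rat.HeightOneSpectrum
  Literature.NumberTheory.EllipticCurves
  Literature.NumberTheory.EllipticCurves.ModularForms
  Literature.NumberTheory.EllipticCurves.Rank1Residual
  Literature.NumberTheory.QuadraticFields
  Summit.BirchSwinnertonDyer.Rank1Residual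
  Summit.BirchSwinnertonDyer.Rank1Residual.Additive

namespace Summit.BirchSwinnertonDyer.BirchSwinnertonDyer.Theorems.WanAnyRoad

open NumberTheorySymbols ZMod
open Summit.BirchSwinnertonDyer.BirchSwinnertonDyer.Theorems.ThreeFieldRoadSupply
open Summit.BirchSwinnertonDyer.BirchSwinnertonDyer.Theorems.AdditiveKoly.RamifiedHabitat (pStar_emod_four eq_of_prime_dvd_pStar)
open Literature.NumberTheory.EllipticCurves.Castella2018.TamagawaQuadratic

section ClassTwo

variable (W : WeierstrassCurve ℚ) [W.IsElliptic] [W.IsGloballyMinimal] (p : ℕ) [hp : Fact p.Prime]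
  (K : Type) [Field K] [NumberField K] {Wd : WeierstrassCurve ℚ} [Wd.IsElliptic]

/-! ### §5 FIELD 2 assembled at the Wan prime `2` (E356 (e)) and the typed supply -/

set_option maxHeartbeats 800000 in
/-- **FIELD 2 of the r0 twin at the Wan prime `2`** (verbatim port of `exists_fieldTwo_gordTwo` with `q := 2`): a `p`-RAMIFIED Kolyvagin
field `K''` for `(Wd, A)` with `2` ramified and a free ramified prime, and a globally minimal `A ≅ Wd^{(d_{K''})}` of analytic rank `0`,
good ordinary at `p`, `ρ̄_{A,p}` onto, non-split multiplicative at `2` with `p ∤ v₂(Δ_A)`, and `p ∤ ∏ c(A)`.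
[cite: FriedbergHoffstein1995, Thm. B (1), as applied in JetchevSkinnerWan2017 §7.4.1] [cite: SilvermanAEC2009, X.5 Cor. 5.4, VII.5.1 and Thm VII.6.1] -/
theorem exists_fieldTwo_gordTwo_two
    (hFH : friedbergHoffstein_exists_heegnerField_splitDivisors_twist_ne_zero)
    (hmod : exists_isNewformOf) (hL : hasEntireLFunction_rat)
    (hp5 : 5 ≤ p) (hw : W.rootNumber = 1) (hcell : N10.CellGordTwo W p) (hsurj : Surj W p)
    (htam : ¬ p ∣ W.tamagawaProduct)
    (h2p : 2 ≠ p) (h2m : W.HasMultiplicativeReductionAtPrime 2)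
    (h2ns : ¬ W.HasSplitMultiplicativeReductionAtPrime 2)
    (h2v : ¬ p ∣ padicValInt 2 W.minimalDiscriminantInt)
    (hK : IsImaginaryQuadratic K) (h2d : (2 : ℤ) ∣ NumberField.discr K)
    (hsplit : ∀ ℓ : ℕ, ℓ.Prime → ℓ ∣ W.conductorNorm ℤ → ℓ ≠ 2 →
      ((Ideal.span {(ℓ : ℤ)}).primesOver (𝓞 K)).ncard = 2)
    (Cd : VariableChange ℚ) (hWd : Cd • W.quadraticTwist (NumberField.discr K : ℚ) = Wd) :
    ∃ (K'' : Type) (_ : Field K'') (_ : NumberField K'')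
      (A : WeierstrassCurve ℚ) (_ : A.IsElliptic) (_ : A.IsGloballyMinimal),
      (IsImaginaryQuadratic K'' ∧ (p : ℤ) ∣ NumberField.discr K'' ∧
        (∀ ℓ : ℕ, ℓ.Prime → ℓ ∣ Wd.conductorNorm ℤ → ¬ (ℓ : ℤ) ∣ NumberField.discr K'' →
          SatisfiesHeegnerHypothesis ℓ K'') ∧
        (∀ ℓ : ℕ, (hℓ : ℓ.Prime) → ℓ ∣ Wd.conductorNorm ℤ → (ℓ : ℤ) ∣ NumberField.discr K'' → ℓ ≠ p →
          (haveI : Fact ℓ.Prime := ⟨hℓ⟩;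
            A.HasMultiplicativeReductionAtPrime ℓ ∧ ¬ A.HasSplitMultiplicativeReductionAtPrime ℓ))) ∧
      (∃ ℓ : ℕ, ℓ.Prime ∧ (ℓ : ℤ) ∣ NumberField.discr K'' ∧ ℓ ≠ p ∧ ¬ ℓ ∣ Wd.conductorNorm ℤ) ∧
      (∃ C : VariableChange ℚ, C • Wd.quadraticTwist (NumberField.discr K'' : ℚ) = A) ∧
      A.analyticRank = 0 ∧ GoodOrd A p ∧ Surj A p ∧
      (∃ ℓ : ℕ, ∃ _ : Fact ℓ.Prime, ℓ ≠ p ∧ A.HasMultiplicativeReductionAtPrime ℓ ∧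
        ¬ p ∣ padicValInt ℓ A.minimalDiscriminantInt) ∧
      ¬ p ∣ A.tamagawaProduct := by
  have hp2 : p ≠ 2 := by omega
  obtain ⟨ℓ₀, e₂, T, d, K'', iF'', iN'', A, iA, iAm, hℓ₀, hℓ₀p, hℓ₀2, hℓ₀NWd, he₂, hdisc, hK'', hsplit'', hram'',
      hAWd, ⟨Cu, hCu⟩, hu4, husq, hJu, hrA, hgoA, hsurjA⟩ :=
    exists_ramifiedClass_partner_two W p K hFH hmod hL hp5 hw hcell hsurj hK h2d hsplit Cd hWd
  have he₂2 : (2 : ℤ) ∣ e₂ := by rcases he₂ with h | h | h <;> rw [h] <;> norm_num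
  set u : ℤ := ((-1 : ℤ) ^ (p / 2) * p) * T * d with hu
  -- `u ≠ 0, 1`, `p ∣ u`
  have hpu : (p : ℤ) ∣ u := by
    rw [hu]
    refine Dvd.dvd.mul_right (Dvd.dvd.mul_right ?_ _) _
    exact Dvd.intro_left _ rfl
  have hu1 : u ≠ 1 := fun h ↦ by
    rw [h] at hpu
    exact hp.out.ne_one (by exact_mod_cast Int.eq_one_of_dvd_one (by norm_num) hpu)
  have hu0 : u ≠ 0 := fun h ↦ by rw [h] at hu4; norm_num at hu4
  have huq : ((u : ℤ) : ℚ) ≠ 0 := by exact_mod_cast hu0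
  -- squares at the bad primes `≠ p` of `E`
  have hsq : ∀ ℓ : ℕ, (hℓ : ℓ.Prime) → ℓ ∣ W.conductorNorm ℤ → ℓ ≠ p →
      (haveI : Fact ℓ.Prime := ⟨hℓ⟩; IsSquare (((u : ℤ) : ℚ) : ℚ_[ℓ])) := by
    intro ℓ hℓ hℓN hℓp
    haveI : Fact ℓ.Prime := ⟨hℓ⟩
    exact isSquare_padic_of_fundamental hu4 husq hu1 (hJu ℓ hℓ hℓN hℓp)
  -- at the Wan prime `2`
  have hqN : 2 ∣ W.conductorNorm ℤ :=
    (W.dvd_conductorNorm_iff_not_hasGoodReductionAtPrime 2).mpr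
      (not_hasGoodReductionAtPrime_of_hasMultiplicativeReductionAtPrime 2 h2m)
  have hsqq : IsSquare (((u : ℤ) : ℚ) : ℚ_[2]) := hsq 2 Nat.prime_two hqN h2p
  have hmultA : A.HasMultiplicativeReductionAtPrime 2 :=
    (X11b.mult_iff_of_twist W huq hsqq A hCu).mpr h2m
  have hnsA : ¬ A.HasSplitMultiplicativeReductionAtPrime 2 := by
    haveI := W.isElliptic_quadraticTwist huq
    rw [← hCu, hasSplitMultiplicativeReductionAtPrime_smul_iff,
      hasSplitMultiplicativeReductionAtPrime_quadraticTwist_iff W huq (by simpa using hsqq)]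
    exact h2ns
  have hΔq : padicValInt 2 A.minimalDiscriminantInt = padicValInt 2 W.minimalDiscriminantInt :=
    X11b.padicValInt_minimalDiscriminantInt_twist_eq W 2 huq (by simpa using hsqq) Cu hCu
  -- the Tamagawa product of `A`
  have hjA : A.j = W.j := AdditivePotMult.j_of_model_twist huq ⟨Cu, hCu⟩
  have htamA : ¬ p ∣ A.tamagawaProduct := by
    refine not_dvd_tamagawaProduct_of_forall A p fun v ↦ ?_
    set ℓ : ℕ := (primesEquiv v : ℕ) with hℓdef
    haveI hℓF : Fact ℓ.Prime := ⟨(primesEquiv v).2⟩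
    by_cases hcase : ℓ ∣ W.conductorNorm ℤ ∧ ℓ ≠ p
    · -- `A ⊗ ℚ_ℓ ≅ E ⊗ ℚ_ℓ`: same local Tamagawa number, and `p ∤ c_ℓ(E)`
      rw [localTamagawaNumber_eq_of_twist_of_isSquare W v (ℓ := ℓ) rfl huq
        (hsq ℓ hℓF.out hcase.1 hcase.2) A hCu]
      intro hdvd
      apply htam
      set cW : HeightOneSpectrum (𝓞 ℚ) → ℕ := fun v =>
        (W.baseChange (v.adicCompletion ℚ)).localTamagawaNumber (v.adicCompletionIntegers ℚ) with hcW
      have hfin : (Function.mulSupport cW).Finite := W.mulSupport_localTamagawaNumber_finite_holds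
      rw [show W.tamagawaProduct = ∏ᶠ v, cW v from rfl,
        finprod_eq_prod_of_mulSupport_subset cW (s := hfin.toFinset) (by simp)]
      by_cases hv1 : cW v = 1
      · exfalso
        have : p ∣ 1 := by rw [← hv1]; exact hdvd
        exact hp.out.ne_one (Nat.dvd_one.mp this)
      · exact hdvd.trans (Finset.dvd_prod_of_mem cW (hfin.mem_toFinset.mpr hv1))
    · -- `A` is not split multiplicative at `v`: `c_v(A) ≤ 4 < p`
      obtain ⟨h1, -, h4⟩ := kodairaNeron_localTamagawaNumber A v
      have hns : ¬ A.HasSplitMultiplicativeReductionAt v := by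
        intro hsplitv
        have hmult := hsplitv.hasMultiplicativeReductionAt
        have hlt := one_lt_valuation_j v A hmult
        have hle : v.valuation ℚ A.j ≤ 1 := by
          by_cases hℓp : ℓ = p
          · -- `A` is good at `p`
            refine Additive.valuation_j_le_one_of_hasGoodReductionAt A v ?_
            refine (hasGoodReductionAtPrime_iff_hasGoodReductionAt_ringOfIntegers v A).mp ?_
            have hg : A.HasGoodReductionAtPrime p := hgoA.1
            have key : ∀ (n : ℕ) (i₁ : Fact n.Prime) (i₂ : Fact p.Prime), n = p →
                @HasGoodReductionAtPrime A p i₂ → @HasGoodReductionAtPrime A n i₁ := by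
              rintro n i₁ i₂ rfl h; exact h
            exact key _ _ _ hℓp hg
          · -- `E` is good at `ℓ ∤ N_E`, and `j(A) = j(E)`
            have hℓN : ¬ ℓ ∣ W.conductorNorm ℤ := fun h ↦ hcase ⟨h, hℓp⟩
            have hgood : W.HasGoodReductionAtPrime ℓ :=
              not_not.mp (mt (W.dvd_conductorNorm_iff_not_hasGoodReductionAtPrime ℓ).mpr hℓN)
            rw [hjA]
            exact Additive.valuation_j_le_one_of_hasGoodReductionAt W v
              ((hasGoodReductionAtPrime_iff_hasGoodReductionAt_ringOfIntegers v W).mp hgood)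
        exact (not_lt.mpr hle) hlt
      have hc4 := h4 hns
      intro hdvd
      have := Nat.le_of_dvd (by omega) hdvd
      omega
  refine ⟨K'', iF'', iN'', A, iA, iAm, ⟨hK'', ?_, ?_, ?_⟩, ⟨ℓ₀, hℓ₀, ?_, hℓ₀p, hℓ₀NWd⟩, hAWd, hrA,
    hgoA, hsurjA, ⟨2, inferInstance, h2p, hmultA, by rw [hΔq]; exact h2v⟩, htamA⟩
  · -- `p ∣ d_{K''}`
    rw [hdisc]
    exact Dvd.dvd.mul_right (Dvd.dvd.mul_right (Dvd.dvd.mul_right (Dvd.intro_left _ rfl) _) _) _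
  · -- every prime of `N_{Wd}` off `d_{K''}` splits in `K''`
    intro ℓ hℓ hℓN hℓD
    have hℓp : ℓ ≠ p := by
      rintro rfl
      apply hℓD
      rw [hdisc]
      exact Dvd.dvd.mul_right (Dvd.dvd.mul_right (Dvd.dvd.mul_right (Dvd.intro_left _ rfl) _) _) _
    have hℓq : ℓ ≠ 2 := by
      rintro rfl
      apply hℓD
      rw [hdisc]
      exact Dvd.dvd.mul_right (Dvd.dvd.mul_right (Dvd.dvd.mul_left he₂2 _) _) _
    exact hsplit'' ℓ hℓ (hℓN.mul_left _) hℓp hℓq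
  · -- the common primes of `N_{Wd}` and `d_{K''}` other than `p`: only `2`, where `A` is non-split
    intro ℓ hℓ hℓN hℓD hℓp
    rcases hram'' ℓ hℓ hℓD (hℓN.mul_left _) with h | h
    · exact (hℓp h).elim
    · subst h
      exact ⟨hmultA, hnsA⟩
  · -- the free prime `ℓ₀ ∣ d_{K''}`
    rw [hdisc]
    exact Dvd.dvd.mul_right (Dvd.dvd.mul_left (Dvd.intro_left _ rfl) _) _

end ClassTwo

/-- **The typed supply `FieldTwoTwo` of the r0-twin workfile** (`WanAnyRoadPortR0.lean` §11), binder for binder. [composition] -/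
theorem fieldTwoTwo_supply :
  ∀ (W : WeierstrassCurve ℚ) [W.IsElliptic] [W.IsGloballyMinimal] (p : ℕ) [Fact p.Prime]
    (K : Type) [Field K] [NumberField K] (Wd : WeierstrassCurve ℚ) [Wd.IsElliptic] [Wd.IsGloballyMinimal],
    friedbergHoffstein_exists_heegnerField_splitDivisors_twist_ne_zero → exists_isNewformOf → hasEntireLFunction_rat →
    5 ≤ p → W.rootNumber = 1 → N10.CellGordTwo W p → Surj W p → ¬ p ∣ W.tamagawaProduct →
    2 ≠ p → W.HasMultiplicativeReductionAtPrime 2 → ¬ W.HasSplitMultiplicativeReductionAtPrime 2 →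
    ¬ p ∣ padicValInt 2 W.minimalDiscriminantInt →
    IsImaginaryQuadratic K → (2 : ℤ) ∣ NumberField.discr K →
    (∀ ℓ : ℕ, ℓ.Prime → ℓ ∣ W.conductorNorm ℤ → ℓ ≠ 2 → ((Ideal.span {(ℓ : ℤ)}).primesOver (𝓞 K)).ncard = 2) →
    (∃ C : VariableChange ℚ, C • W.quadraticTwist (NumberField.discr K : ℚ) = Wd) →
    ∃ (K'' : Type) (_ : Field K'') (_ : NumberField K'')
      (A : WeierstrassCurve ℚ) (_ : A.IsElliptic) (_ : A.IsGloballyMinimal),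
      (IsImaginaryQuadratic K'' ∧ (p : ℤ) ∣ NumberField.discr K'' ∧
        (∀ ℓ : ℕ, ℓ.Prime → ℓ ∣ Wd.conductorNorm ℤ → ¬ (ℓ : ℤ) ∣ NumberField.discr K'' →
          SatisfiesHeegnerHypothesis ℓ K'') ∧
        (∀ ℓ : ℕ, (hℓ : ℓ.Prime) → ℓ ∣ Wd.conductorNorm ℤ → (ℓ : ℤ) ∣ NumberField.discr K'' → ℓ ≠ p →
          (haveI : Fact ℓ.Prime := ⟨hℓ⟩;
            A.HasMultiplicativeReductionAtPrime ℓ ∧ ¬ A.HasSplitMultiplicativeReductionAtPrime ℓ))) ∧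
      (∃ ℓ : ℕ, ℓ.Prime ∧ (ℓ : ℤ) ∣ NumberField.discr K'' ∧ ℓ ≠ p ∧ ¬ ℓ ∣ Wd.conductorNorm ℤ) ∧
      (∃ C : VariableChange ℚ, C • Wd.quadraticTwist (NumberField.discr K'' : ℚ) = A) ∧
      A.analyticRank = 0 ∧ GoodOrd A p ∧ Surj A p ∧
      (∃ ℓ : ℕ, ∃ _ : Fact ℓ.Prime, ℓ ≠ p ∧ A.HasMultiplicativeReductionAtPrime ℓ ∧
        ¬ p ∣ padicValInt ℓ A.minimalDiscriminantInt) ∧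
      ¬ p ∣ A.tamagawaProduct := by
  intro W _ _ p _ K _ _ Wd _ _ hFH hmod hL hp5 hw hcell hsurj htam h2p h2m h2ns h2v hK h2d hsplit hC
  obtain ⟨Cd, hWd⟩ := hC
  exact exists_fieldTwo_gordTwo_two W p K hFH hmod hL hp5 hw hcell hsurj htam h2p h2m h2ns h2v hK h2d hsplit Cd hWd

end Summit.BirchSwinnertonDyer.BirchSwinnertonDyer.Theorems.WanAnyRoad

end
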